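import Summits.PneNP.PneNP.Theorems.PhaseTwinsMacroscopicTwinsAboveDefs
import Summits.PneNP.PneNP.Theorems.PhaseTwinsPolyDepthTwinsAboveChargeVisible

/-!
# Route PhaseTwins, crux `MacroscopicTwinsAbove` (stmt-PneNP-2720): stub `stub_energy`

Line `literal-gadgets-cfi-apparatus`.

The sector optimisation of the explicit weights: for `0 < λ`, `0 < q⁻ < q⁺ < 1`, if every variable occurs in
`≤ D` equation slots, every assignment violates `≥ t` equations of `(E, b)` and the pair coupling dominates
(`K·D·log ρ_F ≤ κ₁·log B`), then every phase vector `Y` of the `b`-twin weighs at most `e^{-K t (Ψ0 - Ψ1)}`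
times the planted phase vector of the `0`-twin: `lgW b Y · e^{K t (Ψ0 − Ψ1)} ≤ lgW 0 lgRef`.

Proof. Four facts about the complex factor `F_c(y) = cxW λ q⁺ q⁻ c y`: positivity, monotonicity in the
vacancies (so `F_c(all +) ≤ F_c(y) ≤ F_c(all −)`), Tseitin covariance `F_c(y ∘ shift g) = F_{c + Σ g}(y)`
(from the structure formula `cxWeight_eq_sum_inner`, reindexing the inner parts by `T ↦ T + g|` and the ends
by `(i, a) ↦ (i, a + g i)`), and charge visibility `F₁ ≤ F₀` (`cxWeight_zero_sub_one_ref`). Then, with `A`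
the aligned variables of `Y` and `h` the assignment read off the anti-aligned ones: an aligned variable has pair
factor `P_anti · B^{-κ₁}`; an equation untouched by `A` has factor `F₀` or `F₁` according to whether `h`
satisfies it; a touched one (at most `D|A|` of them) has factor `≤ F_max ≤ F₁ · ρ_F`; and `h` violates `≥ t`
equations. Termwise comparison of the two products (`weights_assemble`) and `ρ_F^{KD} ≤ B^{κ₁}` give the claim.
-/

noncomputable section

open scoped Classical BigOperators

namespace Summit.PneNP.PneNP.Cruxes.MacroscopicTwinsAbove.LiteralGadgetsCfiApparatus

open Finset
open Literature.Computability.Complexity (slyB one_lt_slyB)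
open Literature.ModelTheory.FiniteModelTheory.CFIMatching (bit)
open Summit.PneNP.PneNP.Cruxes.PolyDepthTwinsAbove.ParityWiredPorts (occP occM pairW CxVert cxGraph cxWeight
  cxW pwPsi cxRho cxWeight_eq_sum_inner cxWeight_zero_sub_one_ref)

-- `Summit.PneNP.PneNP.…` (summit = sub-problem name) trips the duplicate-namespace linter on every declaration.
set_option linter.dupNamespace false

variable {nv m v P κ₁ D K : ℕ}

/-! ## The complex factor: positivity, monotonicity, covariance -/

/-- Positivity of the local factor for nonnegative activity and vacancies (the empty inner part contributes a
positive term, all terms are nonnegative). -/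
private theorem cxWeight_pos {e : ZMod 2} {lam : ℝ} (hlam : 0 ≤ lam) {x : Fin 3 × ZMod 2 → ℝ}
    (h0 : ∀ p, 0 ≤ x p) : 0 < cxWeight e lam x := by
  rw [cxWeight_eq_sum_inner]
  have hfac : ∀ p, 0 < 1 + lam * x p := fun p => by
    have := mul_nonneg hlam (h0 p); linarith
  have hterm : ∀ T ∈ (univ : Finset (Finset (Fin 2 → ZMod 2))), 0 ≤ lam ^ T.card *
      ∏ p ∈ univ.filter (fun p => ∀ S' ∈ T, bit e S' p.1 ≠ p.2), (1 + lam * x p) :=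
    fun T _ => mul_nonneg (pow_nonneg hlam _) (prod_nonneg fun p _ => (hfac p).le)
  refine lt_of_lt_of_le ?_ (Finset.single_le_sum hterm (mem_univ ∅))
  rw [card_empty, pow_zero, one_mul]
  exact prod_pos fun p _ => hfac p

/-- Monotonicity of the local factor in the vacancies (nonnegative coefficients). -/
private theorem cxWeight_mono {e : ZMod 2} {lam : ℝ} (hlam : 0 ≤ lam) {x x' : Fin 3 × ZMod 2 → ℝ}
    (h0 : ∀ p, 0 ≤ x p) (h : ∀ p, x p ≤ x' p) : cxWeight e lam x ≤ cxWeight e lam x' := by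
  rw [cxWeight_eq_sum_inner, cxWeight_eq_sum_inner]
  refine Finset.sum_le_sum fun T _ => mul_le_mul_of_nonneg_left ?_ (pow_nonneg hlam _)
  refine Finset.prod_le_prod (fun p _ => ?_) fun p _ => ?_
  · have := mul_nonneg hlam (h0 p); linarith
  · have := mul_le_mul_of_nonneg_left (h p) hlam; linarith

/-- The `bit_shift` identity: shifting the two free bits by `g|` and the charge by `Σ g` shifts every
represented bit by `g`. -/
private theorem bit_shift (c : ZMod 2) (g : Fin 3 → ZMod 2) (S' : Fin 2 → ZMod 2) (i : Fin 3) :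
    bit (c + ∑ j, g j) (S' + fun j => g (Fin.castSucc j)) i = bit c S' i + g i := by
  have h2 : (2 : ZMod 2) = 0 := by decide
  fin_cases i <;> simp [bit, Fin.sum_univ_three]
  linear_combination (g 0 + g 1) * h2

/-- **Tseitin covariance of the local factor**: shifting the value bit of the ends by `g` is the same as
shifting the charge by `Σ g` (reindex the structure formula). -/
private theorem cxWeight_shift (c : ZMod 2) (lam : ℝ) (g : Fin 3 → ZMod 2) (x : Fin 3 × ZMod 2 → ℝ) :
    cxWeight c lam (fun p => x (p.1, p.2 + g p.1)) = cxWeight (c + ∑ i, g i) lam x := by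
  rw [cxWeight_eq_sum_inner, cxWeight_eq_sum_inner]
  refine Fintype.sum_equiv (Equiv.finsetCongr (Equiv.addRight fun j => g (Fin.castSucc j))) _ _ fun T => ?_
  rw [Equiv.finsetCongr_apply, card_map]
  congr 1
  refine Finset.prod_equiv (Equiv.prodShear (Equiv.refl _) fun i => Equiv.addRight (g i)) (fun p => ?_)
    fun p _ => rfl
  simp only [mem_filter, mem_univ, true_and, Finset.forall_mem_map, Equiv.coe_toEmbedding,
    Equiv.coe_addRight, Equiv.prodShear_apply, Equiv.refl_apply, bit_shift, ne_eq, add_left_inj]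

/-! ## The complex factor as a function of the phases -/

section Phases

variable {lam qp qm : ℝ}

/-- `occP` at phase `+`. -/
private theorem occP_true (qp qm : ℝ) : occP qp qm true = qp := rfl

/-- `occP` at phase `−`. -/
private theorem occP_false (qp qm : ℝ) : occP qp qm false = qm := rfl

/-- `occM` at phase `+`. -/
private theorem occM_true (qp qm : ℝ) : occM qp qm true = qm := rfl

/-- `occM` at phase `−`. -/
private theorem occM_false (qp qm : ℝ) : occM qp qm false = qp := rfl

/-- The vacancy of a `V⁺` port lies in `[1 - q⁺, 1 - q⁻]` and is nonnegative. -/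
private theorem vacancy_bounds (hle : qm ≤ qp) (hqp : qp ≤ 1) (s : Bool) :
    0 ≤ 1 - occP qp qm s ∧ 1 - qp ≤ 1 - occP qp qm s ∧ 1 - occP qp qm s ≤ 1 - qm := by
  cases s
  · rw [occP_false]; exact ⟨by linarith, by linarith, le_rfl⟩
  · rw [occP_true]; exact ⟨by linarith, le_rfl, by linarith⟩

/-- Positivity of the complex factor. -/
private theorem cxW_pos (hlam : 0 ≤ lam) (hle : qm ≤ qp) (hqp : qp ≤ 1) (c : ZMod 2)
    (y : Fin 3 × ZMod 2 → Bool) : 0 < cxW lam qp qm c y := by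
  unfold cxW
  exact div_pos (cxWeight_pos hlam fun p => (vacancy_bounds hle hqp (y p)).1) (pow_pos (by linarith) 10)

/-- The complex factor is largest when all six literal gadgets are in phase `−`. -/
private theorem cxW_le_false (hlam : 0 ≤ lam) (hle : qm ≤ qp) (hqp : qp ≤ 1) (c : ZMod 2)
    (y : Fin 3 × ZMod 2 → Bool) : cxW lam qp qm c y ≤ cxW lam qp qm c fun _ => false := by
  unfold cxW
  refine div_le_div_of_nonneg_right (cxWeight_mono hlam (fun p => (vacancy_bounds hle hqp (y p)).1)
    fun p => ?_) (pow_nonneg (by linarith) 10)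
  rw [occP_false]
  exact (vacancy_bounds hle hqp (y p)).2.2

/-- The complex factor is smallest when all six literal gadgets are in phase `+`. -/
private theorem cxW_true_le (hlam : 0 ≤ lam) (hle : qm ≤ qp) (hqp : qp ≤ 1) (c : ZMod 2)
    (y : Fin 3 × ZMod 2 → Bool) : cxW lam qp qm c (fun _ => true) ≤ cxW lam qp qm c y := by
  unfold cxW
  refine div_le_div_of_nonneg_right (cxWeight_mono hlam (fun p => ?_) fun p => ?_)
    (pow_nonneg (by linarith) 10)
  · rw [occP_true]; linarith
  · rw [occP_true]; exact (vacancy_bounds hle hqp (y p)).2.1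

/-- Tseitin covariance of the complex factor as a function of the phases. -/
private theorem cxW_shift (lam qp qm : ℝ) (c : ZMod 2) (g : Fin 3 → ZMod 2) (y : Fin 3 × ZMod 2 → Bool) :
    cxW lam qp qm c (fun p => y (p.1, p.2 + g p.1)) = cxW lam qp qm (c + ∑ i, g i) y := by
  unfold cxW
  rw [← cxWeight_shift]

/-- Constant phase patterns weigh the same under both charges. -/
private theorem cxW_const (lam qp qm : ℝ) (c c' : ZMod 2) (s : Bool) :
    cxW lam qp qm c (fun _ => s) = cxW lam qp qm c' (fun _ => s) := by
  obtain ⟨d, rfl⟩ : ∃ d, c' = c + d := ⟨c' - c, by ring⟩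
  have h := cxW_shift lam qp qm c ![d, 0, 0] fun _ => s
  have hsum : ∑ i : Fin 3, (![d, 0, 0] : Fin 3 → ZMod 2) i = d := by
    rw [Fin.sum_univ_three]; simp
  rw [hsum] at h
  exact h

/-- Reading an assignment: if the three variables `v i` are anti-aligned and read the bits `g`
(`Y (v i, a) = [a + g i = 0]`), the complex factor of charge `c` is the reference factor of charge
`c + Σ g`. -/
private theorem cxW_read (lam qp qm : ℝ) (c : ZMod 2) (Y : Fin nv × ZMod 2 → Bool) (v : Fin 3 → Fin nv)
    (g : Fin 3 → ZMod 2) (hg : ∀ i a, Y (v i, a) = decide (a + g i = 0)) :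
    cxW lam qp qm c (fun p => Y (v p.1, p.2)) = cxW lam qp qm (c + ∑ i, g i) fun p => decide (p.2 = 0) := by
  rw [← cxW_shift]
  congr 1
  funext p
  exact hg p.1 p.2

/-- `F₁ ≤ F₀`: the satisfied reference factor beats the violated one
(`F₀ - F₁ = λ⁴ (q⁺ - q⁻)³ / (1+λ)^{10}`, `cxWeight_zero_sub_one_ref`). -/
private theorem cxW_one_ref_le (hlam : 0 ≤ lam) (hle : qm ≤ qp) :
    cxW lam qp qm 1 (fun p => decide (p.2 = 0)) ≤ cxW lam qp qm 0 fun p => decide (p.2 = 0) := by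
  unfold cxW
  refine div_le_div_of_nonneg_right (sub_nonneg.1 ?_) (pow_nonneg (by linarith) 10)
  rw [cxWeight_zero_sub_one_ref]
  exact mul_nonneg (pow_nonneg hlam 4) (pow_nonneg (sub_nonneg.2 hle) 3)

/-- A touched equation: whatever its phases, its factor times the contrast `F₀/F₁` (or `1`) is at most
`F₀ · ρ_F`, because `F_c(y) ≤ F_max` and `F_max / F₁ ≤ F_max / F_min = ρ_F`. -/
private theorem cx_touched_le (hlam : 0 ≤ lam) (hle : qm ≤ qp) (hqp : qp ≤ 1) (c : ZMod 2)
    (y : Fin 3 × ZMod 2 → Bool) (Q : Prop) [Decidable Q] :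
    cxW lam qp qm c y * (if Q then cxW lam qp qm 0 (fun p => decide (p.2 = 0)) /
        cxW lam qp qm 1 (fun p => decide (p.2 = 0)) else 1) ≤
      cxW lam qp qm 0 (fun p => decide (p.2 = 0)) * cxRho lam qp qm := by
  have hpos := cxW_pos hlam hle hqp
  have hmax : cxW lam qp qm c y ≤ cxW lam qp qm 0 fun _ => false :=
    (cxW_le_false hlam hle hqp c y).trans (cxW_const lam qp qm c 0 false).le
  have hmin : cxW lam qp qm 0 (fun _ => true) ≤ cxW lam qp qm 1 fun p => decide (p.2 = 0) :=
    (cxW_const lam qp qm 0 1 true).le.trans (cxW_true_le hlam hle hqp 1 _)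
  have hQ : (if Q then cxW lam qp qm 0 (fun p => decide (p.2 = 0)) /
      cxW lam qp qm 1 (fun p => decide (p.2 = 0)) else 1) ≤
      cxW lam qp qm 0 (fun p => decide (p.2 = 0)) / cxW lam qp qm 1 (fun p => decide (p.2 = 0)) := by
    split_ifs
    · exact le_rfl
    · exact (one_le_div (hpos 1 _)).2 (cxW_one_ref_le hlam hle)
  calc cxW lam qp qm c y * (if Q then cxW lam qp qm 0 (fun p => decide (p.2 = 0)) /
          cxW lam qp qm 1 (fun p => decide (p.2 = 0)) else 1)
      ≤ cxW lam qp qm 0 (fun _ => false) * (cxW lam qp qm 0 (fun p => decide (p.2 = 0)) /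
          cxW lam qp qm 1 (fun p => decide (p.2 = 0))) :=
        mul_le_mul hmax hQ (by split_ifs; exacts [(div_pos (hpos 0 _) (hpos 1 _)).le, zero_le_one]) (hpos 0 _).le
    _ = cxW lam qp qm 0 (fun p => decide (p.2 = 0)) * (cxW lam qp qm 0 (fun _ => false) /
          cxW lam qp qm 1 (fun p => decide (p.2 = 0))) := by ring
    _ ≤ cxW lam qp qm 0 (fun p => decide (p.2 = 0)) * cxRho lam qp qm :=
        mul_le_mul_of_nonneg_left (div_le_div_of_nonneg_left (hpos 0 _).le (hpos 0 _) hmin) (hpos 0 _).le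

/-! ## The pair factor -/

/-- Nonnegativity of the pair factor. -/
private theorem pairW_nonneg (hqm : 0 ≤ qm) (hle : qm ≤ qp) (hqp : qp ≤ 1) (κ₁ : ℕ) (s t : Bool) :
    0 ≤ pairW qp qm κ₁ s t := by
  have h1 : ∀ a c : ℝ, 0 ≤ a → a ≤ 1 → 0 ≤ c → c ≤ 1 → 0 ≤ 1 - a * c :=
    fun a c ha ha1 hc hc1 => by nlinarith
  have hqp0 : 0 ≤ qp := hqm.trans hle
  have hqm1 : qm ≤ 1 := hle.trans hqp
  unfold pairW
  cases s <;> cases t <;> simp only [occP_true, occP_false, occM_true, occM_false] <;>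
    exact pow_nonneg (mul_nonneg (h1 _ _ ‹_› ‹_› ‹_› ‹_›) (h1 _ _ ‹_› ‹_› ‹_› ‹_›)) _

/-- The two anti-aligned pair factors agree. -/
private theorem pairW_false_true (qp qm : ℝ) (κ₁ : ℕ) :
    pairW qp qm κ₁ false true = pairW qp qm κ₁ true false := by
  simp only [pairW, occP_true, occP_false, occM_true, occM_false]
  ring

/-- An aligned pair factor times `B^{κ₁}` is the anti-aligned pair factor
(`(1-q⁺²)(1-q⁻²) · B = (1 - q⁺q⁻)²`). -/
private theorem pairW_self_mul (hqm : 0 < qm) (hlt : qm < qp) (hqp : qp < 1) (κ₁ : ℕ) (s : Bool) :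
    pairW qp qm κ₁ s s * slyB qp qm ^ κ₁ = pairW qp qm κ₁ true false := by
  have h1 : (1 - qp ^ 2) ≠ 0 := by nlinarith
  have h2 : (1 - qm ^ 2) ≠ 0 := by nlinarith
  unfold pairW slyB
  rw [← mul_pow]
  congr 1
  cases s <;> simp only [occP_true, occP_false, occM_true, occM_false] <;> field_simp

end Phases

/-! ## Counting and assembling -/

/-- The equations touched by a set `A` of variables number at most `D · |A|` if every variable occurs in at most
`D` slots. -/
private theorem card_touched_le (E : Fin m → Fin 3 → Fin nv)
    (hocc : ∀ x : Fin nv, (Finset.univ.filter fun p : Fin m × Fin 3 => E p.1 p.2 = x).card ≤ D)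
    (A : Finset (Fin nv)) : (univ.filter fun e : Fin m => ∃ i, E e i ∈ A).card ≤ D * A.card := by
  calc (univ.filter fun e : Fin m => ∃ i, E e i ∈ A).card
      ≤ (A.biUnion fun x => (univ.filter fun p : Fin m × Fin 3 => E p.1 p.2 = x).image Prod.fst).card := by
        refine card_le_card fun e he => ?_
        obtain ⟨i, hi⟩ := (mem_filter.1 he).2
        exact mem_biUnion.2 ⟨E e i, hi, mem_image.2 ⟨(e, i), mem_filter.2 ⟨mem_univ _, rfl⟩, rfl⟩⟩
    _ ≤ ∑ x ∈ A, ((univ.filter fun p : Fin m × Fin 3 => E p.1 p.2 = x).image Prod.fst).card :=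
        card_biUnion_le
    _ ≤ ∑ x ∈ A, D := sum_le_sum fun x _ => card_image_le.trans (hocc x)
    _ = D * A.card := by rw [sum_const, smul_eq_mul, mul_comm]

/-- The bookkeeping of the sector inequality, on opaque reals: pair factors `Pf x` (bounded by `Panti` after
multiplying the aligned ones by `ρ`), complex factors `G e` (bounded by `F0`, resp. `F0 · R` on the touched
equations, after multiplying the violated ones by the contrast `q ≥ 1`), `t ≤ #violated` and
`R^{#touched · K} ≤ ρ^{|A|}`. -/
private theorem weights_assemble (Pf : Fin nv → ℝ) (A : Finset (Fin nv)) (G : Fin m → ℝ)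
    (Viol Tch : Finset (Fin m)) {F0 q R ρ Panti : ℝ} {K t : ℕ} (hPf : ∀ x, 0 ≤ Pf x) (hρ : 0 ≤ ρ)
    (hpair : ∀ x, Pf x * (if x ∈ A then ρ else 1) ≤ Panti) (hG : ∀ e, 0 ≤ G e) (hF0 : 0 ≤ F0)
    (hcx : ∀ e, G e * (if e ∈ Viol then q else 1) ≤ F0 * (if e ∈ Tch then R else 1))
    (hq : 1 ≤ q) (hR : 1 ≤ R) (ht : t ≤ Viol.card) (hTch : R ^ (Tch.card * K) ≤ ρ ^ A.card) :
    (∏ x, Pf x) * (∏ e, G e ^ K) * (q ^ t) ^ K ≤ (∏ _x : Fin nv, Panti) * ∏ _e : Fin m, F0 ^ K := by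
  have hPnn : 0 ≤ ∏ x, Pf x := prod_nonneg fun x _ => hPf x
  have hGnn : 0 ≤ ∏ e, G e := prod_nonneg fun e _ => hG e
  have hq0 : 0 ≤ q := zero_le_one.trans hq
  have hR0 : 0 ≤ R := zero_le_one.trans hR
  calc (∏ x, Pf x) * (∏ e, G e ^ K) * (q ^ t) ^ K
      = (∏ x, Pf x) * ((∏ e, G e) * q ^ t) ^ K := by rw [prod_pow, mul_pow, mul_assoc]
    _ ≤ (∏ x, Pf x) * ((∏ e, G e) * q ^ Viol.card) ^ K :=
        mul_le_mul_of_nonneg_left (pow_le_pow_left₀ (mul_nonneg hGnn (pow_nonneg hq0 _))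
          (mul_le_mul_of_nonneg_left (pow_le_pow_right₀ hq ht) hGnn) K) hPnn
    _ = (∏ x, Pf x) * (∏ e, G e * if e ∈ Viol then q else 1) ^ K := by
        rw [prod_mul_distrib, Fintype.prod_ite_mem, prod_const]
    _ ≤ (∏ x, Pf x) * (∏ e, F0 * if e ∈ Tch then R else 1) ^ K := by
        refine mul_le_mul_of_nonneg_left (pow_le_pow_left₀ (prod_nonneg fun e _ => ?_)
          (prod_le_prod (fun e _ => ?_) fun e _ => hcx e) K) hPnn <;>
        exact mul_nonneg (hG e) (by split_ifs; exacts [hq0, zero_le_one])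
    _ = (∏ x, Pf x) * R ^ (Tch.card * K) * ∏ _e : Fin m, F0 ^ K := by
        simp only [prod_mul_distrib, Fintype.prod_ite_mem, prod_const, card_univ]
        ring
    _ ≤ (∏ x, Pf x) * ρ ^ A.card * ∏ _e : Fin m, F0 ^ K :=
        mul_le_mul_of_nonneg_right (mul_le_mul_of_nonneg_left hTch hPnn)
          (prod_nonneg fun _ _ => pow_nonneg hF0 K)
    _ = (∏ x, Pf x * if x ∈ A then ρ else 1) * ∏ _e : Fin m, F0 ^ K := by
        rw [prod_mul_distrib, Fintype.prod_ite_mem, prod_const, prod_const]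
    _ ≤ (∏ _x : Fin nv, Panti) * ∏ _e : Fin m, F0 ^ K :=
        mul_le_mul_of_nonneg_right (prod_le_prod (fun x _ => mul_nonneg (hPf x)
          (by split_ifs; exacts [hρ, zero_le_one])) fun x _ => hpair x)
          (prod_nonneg fun _ _ => pow_nonneg hF0 K)

/-- Every element of `ZMod 2` is `0` or `1`. -/
private theorem zmod_two_cases : ∀ a : ZMod 2, a = 0 ∨ a = 1 := by decide

/-- An anti-aligned variable reads a bit: `Y (x, a) = [a + h x = 0]` with `h x = [Y (x, 0) = −]`. -/
private theorem read_bit (Y : Fin nv × ZMod 2 → Bool) (x : Fin nv) (hx : Y (x, 0) ≠ Y (x, 1)) (a : ZMod 2) :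
    Y (x, a) = decide (a + (if Y (x, 0) then 0 else 1) = 0) := by
  have h11 : (1 : ZMod 2) + 1 = 0 := by decide
  rcases zmod_two_cases a with rfl | rfl <;> cases h0 : Y (x, 0) <;> cases h1 : Y (x, 1) <;>
    simp_all

/-! ## The stub -/

/-- **S6 — the sector optimisation of the weights** (stub `stub_energy` of the line
`literal-gadgets-cfi-apparatus`). For `λ > 0`, `0 < q⁻ < q⁺ < 1`: if every variable occurs in `≤ D` equation
slots, every assignment violates `≥ t` equations of `(E, b)`, and the pair coupling dominates
(`K·D·log ρ_F ≤ κ₁·log B`), then every phase vector `Y` of the `b`-twin weighs at most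
`e^{−K t (Ψ0−Ψ1)}` times the reference vector of the `0`-twin. -/
theorem stub_energy {lam qp qm : ℝ} (hlam : 0 < lam) (hqm : 0 < qm) (hlt : qm < qp) (hqp : qp < 1)
    {nv m D K κ₁ : ℕ} (E : Fin m → Fin 3 → Fin nv)
    (hocc : ∀ x : Fin nv, (Finset.univ.filter fun p : Fin m × Fin 3 => E p.1 p.2 = x).card ≤ D)
    (b : Fin m → ZMod 2) (t : ℕ)
    (hfar : ∀ f : Fin nv → ZMod 2,
      t ≤ (Finset.univ.filter fun e : Fin m => ∑ i : Fin 3, f (E e i) ≠ b e).card)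
    (hcouple : (K * D : ℝ) * Real.log (cxRho lam qp qm) ≤ κ₁ * Real.log (slyB qp qm))
    (Y : Fin nv × ZMod 2 → Bool) :
    lgW E lam qp qm κ₁ K b Y * Real.exp (K * t * (pwPsi lam qp qm 0 - pwPsi lam qp qm 1)) ≤
      lgW E lam qp qm κ₁ K 0 lgRef := by
  have hle := hlt.le
  have hpos := cxW_pos hlam.le hle hqp.le
  have h10 := cxW_one_ref_le (qp := qp) hlam.le hle
  have hq : 1 ≤ cxW lam qp qm 0 (fun p => decide (p.2 = 0)) / cxW lam qp qm 1 (fun p => decide (p.2 = 0)) :=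
    (one_le_div (hpos 1 _)).2 h10
  have hR1 : 1 ≤ cxRho lam qp qm :=
    (one_le_div (hpos 0 _)).2 (cxW_true_le hlam.le hle hqp.le 0 _)
  have hRpos : 0 < cxRho lam qp qm := one_pos.trans_le hR1
  have hB : 1 < slyB qp qm := one_lt_slyB hqm hlt hqp
  have hRB : cxRho lam qp qm ^ (K * D) ≤ slyB qp qm ^ κ₁ := by
    rw [← Real.log_le_log_iff (pow_pos hRpos _) (pow_pos (one_pos.trans hB) _), Real.log_pow,
      Real.log_pow, Nat.cast_mul]
    exact hcouple
  -- the exponential factor is the `K t`-th power of the contrast `F₀ / F₁`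
  have hexp : Real.exp (K * t * (pwPsi lam qp qm 0 - pwPsi lam qp qm 1)) =
      ((cxW lam qp qm 0 (fun p => decide (p.2 = 0)) / cxW lam qp qm 1 (fun p => decide (p.2 = 0))) ^ t) ^ K := by
    rw [← Nat.cast_mul, Real.exp_nat_mul, Real.exp_sub, pow_mul']
    unfold pwPsi
    rw [Real.exp_log (hpos 0 _), Real.exp_log (hpos 1 _)]
  -- the aligned variables and the assignment read off the anti-aligned ones
  set A : Finset (Fin nv) := univ.filter fun x => Y (x, 0) = Y (x, 1)
  obtain ⟨h, hh⟩ : ∃ h : Fin nv → ZMod 2, h = fun x => if Y (x, 0) then 0 else 1 := ⟨_, rfl⟩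
  have hread : ∀ x, x ∉ A → ∀ a, Y (x, a) = decide (a + h x = 0) := fun x hx a => by
    rw [hh]
    exact read_bit Y x (fun heq => hx (mem_filter.2 ⟨mem_univ _, heq⟩)) a
  have hTch : cxRho lam qp qm ^ ((univ.filter fun e : Fin m => ∃ i, E e i ∈ A).card * K) ≤
      (cxRho lam qp qm ^ (K * D)) ^ A.card := by
    rw [← pow_mul]
    refine pow_le_pow_right₀ hR1 ?_
    calc (univ.filter fun e : Fin m => ∃ i, E e i ∈ A).card * K ≤ D * A.card * K :=
          Nat.mul_le_mul_right K (card_touched_le E hocc A)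
      _ = K * D * A.card := by ring
  have key := weights_assemble (fun x => pairW qp qm κ₁ (Y (x, 0)) (Y (x, 1))) A
    (fun e => cxW lam qp qm (b e) fun p => Y (E e p.1, p.2))
    (univ.filter fun e : Fin m => ∑ i : Fin 3, h (E e i) ≠ b e) (univ.filter fun e : Fin m => ∃ i, E e i ∈ A)
    (F0 := cxW lam qp qm 0 fun p => decide (p.2 = 0)) (Panti := pairW qp qm κ₁ true false)
    (fun x => pairW_nonneg hqm.le hle hqp.le κ₁ _ _) (pow_nonneg hRpos.le _) (fun x => ?_)
    (fun e => (hpos _ _).le) (hpos 0 _).le (fun e => ?_) hq hR1 (hfar h) hTch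
  · -- conclusion
    have hRHS : lgW E lam qp qm κ₁ K 0 lgRef = (∏ _x : Fin nv, pairW qp qm κ₁ true false) *
        ∏ _e : Fin m, (cxW lam qp qm 0 fun p : Fin 3 × ZMod 2 => decide (p.2 = 0)) ^ K := by
      unfold lgW lgRef
      exact congrArg₂ (· * ·) (prod_congr rfl fun x _ => by simp) (prod_congr rfl fun e _ => rfl)
    rw [hexp, hRHS]
    exact key
  · -- pair factors
    by_cases hx : x ∈ A
    · have hx' : Y (x, 0) = Y (x, 1) := (mem_filter.1 hx).2
      rw [if_pos hx, hx']
      calc pairW qp qm κ₁ (Y (x, 1)) (Y (x, 1)) * cxRho lam qp qm ^ (K * D)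
          ≤ pairW qp qm κ₁ (Y (x, 1)) (Y (x, 1)) * slyB qp qm ^ κ₁ :=
            mul_le_mul_of_nonneg_left hRB (pairW_nonneg hqm.le hle hqp.le κ₁ _ _)
        _ = pairW qp qm κ₁ true false := pairW_self_mul hqm hlt hqp κ₁ _
    · have hx' : Y (x, 0) ≠ Y (x, 1) := fun heq => hx (mem_filter.2 ⟨mem_univ _, heq⟩)
      rw [if_neg hx, mul_one]
      cases h0 : Y (x, 0) <;> cases h1 : Y (x, 1)
      · exact absurd (h0.trans h1.symm) hx'
      · exact (pairW_false_true qp qm κ₁).le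
      · exact le_rfl
      · exact absurd (h0.trans h1.symm) hx'
  · -- complex factors
    by_cases hT : e ∈ univ.filter fun e : Fin m => ∃ i, E e i ∈ A
    · rw [if_pos hT]
      exact cx_touched_le hlam.le hle hqp.le (b e) _ _
    · rw [if_neg hT, mul_one]
      have hanti : ∀ i, E e i ∉ A := fun i hi => hT (mem_filter.2 ⟨mem_univ _, i, hi⟩)
      rw [cxW_read lam qp qm (b e) Y (E e) (fun i => h (E e i)) fun i a => hread _ (hanti i) a]
      have hbb : ∀ c s : ZMod 2, s ≠ c → c + s = 1 := by decide
      have hcc : ∀ c : ZMod 2, c + c = 0 := by decide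
      by_cases hV : e ∈ univ.filter fun e : Fin m => ∑ i : Fin 3, h (E e i) ≠ b e
      · rw [if_pos hV, hbb _ _ (mem_filter.1 hV).2]
        exact (mul_div_cancel₀ _ (hpos 1 _).ne').le
      · rw [if_neg hV, mul_one]
        have hs : ∑ i : Fin 3, h (E e i) = b e := not_not.1 fun hne => hV (mem_filter.2 ⟨mem_univ _, hne⟩)
        rw [hs, hcc]

end Summit.PneNP.PneNP.Cruxes.MacroscopicTwinsAbove.LiteralGadgetsCfiApparatus
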